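import Summits.BirchSwinnertonDyer.BirchSwinnertonDyer.Theorems.EisensteinPrimesBSDpOnCellCImprimitiveCountSplitOfBrHlatLight
import Literature.NumberTheory.GaloisCohomology.RestrictedRamificationPoitouTateThreeLeTotallyComplex
import HarnessLib

/-!
# Crux 4 `BSDpOnCellC` (stmt-BirchSwinnertonDyer-19034), line crystal v6 → v7 — the LIGHT split hlat-count with `cd_p G_{K,S} ≤ 2` DISCHARGED
# (cell `bsd-eis`, width seat `bsd-line-x2-p2` gen 12; skeleton UNCHANGED, W-79; the variant asked for by the LEAD `cruxlead-19034` g0, bus 2026-08-29T01:18:29Z)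

WHY. p684434 `SplitMultWallHlatLight.imprimitiveCount_split_hlatLight_of_br_of_pub` (gen 11) — the split conjunct of the wall at Keller–Yin's
normalised lattice in the light telescope, consumed BY NAME in crystal v6's `BSDpOnCellC_of` (slot `hcountS`, through p684074's transport) — takes
`hCD2 : ∀ (L : Type) [Field L] [NumberField L], groupCdLE_two_galoisGroupUnramifiedOutside L` (Harari Cor. 17.14 / NSW (8.3.18): `cd_p G_{L,S} ≤ 2`,
guarded «`p ≠ 2` if `L` has a real place») and uses it ONLY as `(hCD2 K)` at the imaginary quadratic field `K` of the datum. To feed that binder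
by name the LEAD had to append the conjunct `∀ L, groupCdLE_two_galoisGroupUnramifiedOutside L` to `stub_publishedFacts.2` in v6 (28 PUB). But at a
TOTALLY COMPLEX field it is a tree THEOREM since 2026-08-29 (x1 lane PT3-TC): `groupCdLE_two_galoisGroupUnramifiedOutside_of_isTotallyComplex
[IsTotallyComplex K] : groupCdLE_two_galoisGroupUnramifiedOutside K` (`Literature/NumberTheory/GaloisCohomology/RestrictedRamificationPoitouTateThreeLeTotallyComplex.lean`,
sorry-free, standard axioms), and `IsImaginaryQuadratic K` is by definition `finrank ℚ K = 2 ∧ IsTotallyComplex K`.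

RESULT. `imprimitiveCount_split_hlatLight_of_br_of_pub_tc` — p684434's statement VERBATIM minus the `hCD2` binder (binder list
`h263 h41 h42 h5A h32 hF1 hbr hω han`); proof = p684434's proof verbatim with `(hCD2 K)` ↦
`(haveI := hK.2; groupCdLE_two_galoisGroupUnramifiedOutside_of_isTotallyComplex (K := K))`. For the LEAD (crystal v7, by name):
`hcountS := ImprimitiveCountSplitTransport.imprimitiveCount_split_of_hlatLight <exists_isNewformOf> (SplitMultWallHlatLight.imprimitiveCount_split_hlatLight_of_br_of_pub_tc h263 h41 h42 h5A h32 hF1 hbr hωS hanS)`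
— and the NSW conjunct of `stub_publishedFacts.2` goes (28 → 27 PUB; `stub_publishedFacts` token-identical to v4.1 again).
Placed in a NEW file rather than appended to p684434's (298 l.) because the append would exceed the 400-line file limit (CONVENTIONS §1); same
namespace `…Theorems.SplitMultWallHlatLight`, so the fully qualified name is the one the LEAD asked for.

HONEST FRAMING: helper theorem only (0 defs, 0 named facts introduced, 0 sorry); CONDITIONAL on five named PUB facts (Greenberg 2016 Prop. 2.6.3;
Greenberg 2006 Props. 4.1, 4.2, §5 A, 3.2; CGLS Thm. 2.1.2 via `hF1`), on [BR𝟙] `CharMainConjOnTree` (PRE, by name) and on the inline light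
[BRω-split] / [AN-split] sentences (unprinted at `p ‖ N`); closes no stub by itself; no summit statement / BSD / MC / IMC is proved for any curve;
0 cells / labels / tiers move.

References: [Harari2020] Cor. 17.14; [NeukirchSchmidtWingberg2008] (8.3.18), (10.9.3); [KellerYin2024] §0.1 L263, Lemma 5.1.1–5.1.2, §5.1 (b),
Thm. 1.4.1 (iii) (arXiv:2402.12781v2); [CastellaGrossiLeeSkinner2022] Thm. 1.2.2, Prop. 1.2.5, Thm. 2.1.2, Thm. 2.2.2 with (2.16);
[Greenberg2016Selmer] Prop. 2.6.3; [Greenberg2006] Props. 3.2, 4.1, 4.2, §5 A; [GreenbergVatsal2000] §2 pp. 14–15; p684434 (g11), p684074 (g11).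
-/

set_option autoImplicit false
set_option linter.dupNamespace false -- the summit namespace `…BirchSwinnertonDyer.BirchSwinnertonDyer.Theorems` (Sub = Summit, D-0017) trips it

noncomputable section

open scoped Classical MatrixGroups ModularForm

open CongruenceSubgroup WeierstrassCurve NumberField IsDedekindDomain Field PowerSeries
  Literature.NumberTheory.EllipticCurves Literature.NumberTheory.EllipticCurves.GreenbergSelmer
  Literature.NumberTheory.EllipticCurves.ModularForms Literature.NumberTheory.QuadraticFields
  Literature.NumberTheory.EllipticCurves.Rank1Residual
  Literature.NumberTheory.EllipticCurves.Rank1Residual.Typed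
  Literature.NumberTheory.EllipticCurves.KrizLi2019
  Literature.NumberTheory.EllipticCurves.GreenbergVatsal2000
  Literature.NumberTheory.EllipticCurves.Wuthrich2014
  Literature.NumberTheory.EllipticCurves.SteinWuthrich2013
  Literature.NumberTheory.EllipticCurves.Castella2018Exceptional
  Literature.NumberTheory.EllipticCurves.Castella2018
  Literature.NumberTheory.GaloisRepresentations Literature.NumberTheory.GaloisCohomology
  Literature.NumberTheory.Automorphic
  Literature.NumberTheory.EllipticCurves.CastellaGrossiLeeSkinner2022
  Literature.NumberTheory.IwasawaTheory Literature.NumberTheory.IwasawaTheory.Greenberg2016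
  Literature.NumberTheory.IwasawaTheory.Greenberg2006
  Summit.BirchSwinnertonDyer.Rank1Residual.X11b.AcSelmer
  Summit.BirchSwinnertonDyer.Rank1Residual.X11b.Halves
  Summit.BirchSwinnertonDyer.Rank1Residual.X11b
  Summit.BirchSwinnertonDyer.Rank1Residual Summit.BirchSwinnertonDyer.Rank1Residual.X1
  Summit.BirchSwinnertonDyer.Rank1Residual.X1.KellerYinMuLambdaSplit
  Summit.BirchSwinnertonDyer.Rank1Residual.X2
  Summit.BirchSwinnertonDyer.BirchSwinnertonDyer.Theorems
  Summit.BirchSwinnertonDyer.BirchSwinnertonDyer.Theorems.EisensteinPrimesMuLambda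
open Literature.NumberTheory.EllipticCurves.KellerYin2024

namespace Summit.BirchSwinnertonDyer.BirchSwinnertonDyer.Theorems.SplitMultWallHlatLight

variable {p : ℕ} [hp : Fact p.Prime]

/-- **THE SPLIT CONJUNCT OF THE WALL AT KELLER–YIN's NORMALISED LATTICE, LIGHT TELESCOPE, `cd_p G_{K,S} ≤ 2` DISCHARGED** — p684434's
`imprimitiveCount_split_hlatLight_of_br_of_pub` WITHOUT its binder `hCD2 : ∀ L, groupCdLE_two_galoisGroupUnramifiedOutside L`: for every split
X2c pair `(W, p)` whose rational `p`-lines are all RAMIFIED at `p` and every light datum, `m + Σ_{w∈Sf} λ(𝒫_w(f)) ≤ λ(X_ac^{Sf}(E_K[p^∞]))`, from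
FIVE published named facts (Greenberg 2016 Prop. 2.6.3; Greenberg 2006 Props. 4.1, 4.2, §5 A, 3.2) + CGLS Thm. 2.1.2 (`hF1`), [BR𝟙]
`X1.KellerYinMuLambdaSplit.CharMainConjOnTree` BY NAME, and the two inline light statements [BRω-split] (`hω`) and [AN-split] (`han`). The
`cd_p ≤ 2` input of the algebraic side (`SplitMultAlgebraicSide.lambdaInvariant_primitive_add_sum_le_of_split`) is needed only at the imaginary
quadratic — hence totally complex — field `K`, where it is the tree theorem `groupCdLE_two_galoisGroupUnramifiedOutside_of_isTotallyComplex`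
(instance from `hK.2`). Otherwise the proof is p684434's, token for token. The conclusion is EXACTLY the hypothesis `hlight` of
`ImprimitiveCountSplitTransport.imprimitiveCount_split_of_hlatLight` (p684074).
[cite: Harari2020, Cor. 17.14 (p. 295)] [cite: NeukirchSchmidtWingberg2008, (8.3.18) and (10.9.3)]
[cite: KellerYin2024, §0.1 L263 and §1.3 L886 (the normalisation), Lemma 5.1.2 and §5.1 (b) (the wall; shape only), Thm. 1.4.1 (iii) (arXiv:2402.12781v2)]
[cite: CastellaGrossiLeeSkinner2022, Thm. 1.2.2, Prop. 1.2.5, Thm. 2.1.2, Thm. 2.2.2 with (2.16)] [cite: Greenberg2016Selmer, Prop. 2.6.3]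
[cite: Greenberg2006, Props. 3.2, 4.1, 4.2, §5 A] [cite: GreenbergVatsal2000, §2 pp. 14–15] -/
theorem imprimitiveCount_split_hlatLight_of_br_of_pub_tc
    (h263 : prop263_sur_of_crk) (h41 : prop41_globalEulerPoincareCorank)
    (h42 : prop42_localEulerPoincareCorank) (h5A : sec5A_localH2_subsingleton_of_LOC1)
    (h32 : prop32_cohomology_isCofinitelyGenerated)
    (hF1 : thm212_exists_isKatzLFunction)
    (hbr : ∀ (p : ℕ) [Fact p.Prime], CharMainConjOnTree p)
    (hω :
      (∀ (W : WeierstrassCurve ℚ) [W.IsElliptic] [W.IsGloballyMinimal] (p : ℕ) [Fact p.Prime],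
        ∀ (N : ℕ) [NeZero N] (K : Type) [Field K] [NumberField K],
          CellC W p → W.HasSplitMultiplicativeReductionAtPrime p → W.conductorNorm ℤ = N →
          IsImaginaryQuadratic K → NumberField.discr K < -4 → SatisfiesHeegnerHypothesis N K →
          Odd (NumberField.discr K) →
          ∀ (κ : ZpExtension K p), κ.IsAnticyclotomic →
            ∀ (γ : Field.absoluteGaloisGroup K) [Fact (κ.IsTopGenerator γ)]
              (𝔭 : HeightOneSpectrum (𝓞 K)), ((p : ℕ) : 𝓞 K) ∈ 𝔭.asIdeal →
              𝔭.asIdeal.ramificationIdx (𝓞 ℚ) = 1 → 𝔭.asIdeal.inertiaDeg (𝓞 ℚ) = 1 →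
              ∀ (𝔭bar : HeightOneSpectrum (𝓞 K)), ((p : ℕ) : 𝓞 K) ∈ 𝔭bar.asIdeal → 𝔭bar ≠ 𝔭 →
                ((Ideal.span {(p : ℤ)}).primesOver (𝓞 K)).ncard = 2 →
              ∀ (ι' : PadicAlgCl p ≃+* ℂ),
                  (∀ (w : InfinitePlace K) (k : 𝓞 K),
                    k ∈ 𝔭.asIdeal ↔ ‖ι'.symm (w.embedding (k : K))‖ < 1) →
                      ∀ (Φ : AddSubgroup (geomTorsion W (p : ℤ))), IsRationalLine W p Φ →
                      ∀ (θsub θquot : FramedGaloisRep ℚ (padicCoeffIntegers (∅ : Set (PadicAlgCl p))) 1),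
                        IsTeichmullerLiftOn (∅ : Set (PadicAlgCl p)) (Φ.map (geomTorsion W (p : ℤ)).subtype) θsub →
                        IsTeichmullerLiftOnQuot (∅ : Set (PadicAlgCl p)) (Φ.map (geomTorsion W (p : ℤ)).subtype)
                          (geomTorsion W (p : ℤ)) θquot →
                      ∀ (φ ψ : FramedGaloisRep ℚ (padicCoeffIntegers (∅ : Set (PadicAlgCl p))) 1),
                        (φ = θsub ∧ ψ = θquot ∨ φ = θquot ∧ ψ = θsub) →
                        (∀ u : HeightOneSpectrum (𝓞 ℚ), ((p : ℕ) : 𝓞 ℚ) ∈ u.asIdeal → φ.IsUnramifiedAt u) →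
                      ∀ (θK : HeckeCharacter K), IsHeckeCharOf ι' (φ.restrictField K) θK →
                      ∀ (Cbar : Finset (HeightOneSpectrum (𝓞 K))), (∀ u ∈ Cbar, ¬ θK.IsUnramifiedAt u) →
                      ∀ (ΩK' : ℂ) (Ωp' : (unrIntegers p)ˣ) (Lφ : UnrSeries p), ΩK' ≠ 0 →
                        IsKatzLFunction ι' 𝔭 𝔭bar Cbar κ γ θK ΩK' ((Ωp' : unrIntegers p) : ℂ_[p]) Lφ →
                      ∀ nφ : ℕ, FirstUnitCoeffAt Lφ nφ →
                      ∀ (Dψ : DatumDualData κ γ (charModule (∅ : Set (PadicAlgCl p)) (ψ.restrictField K))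
                          (Castella2018.AcSelmer.bdpData (charModule (∅ : Set (PadicAlgCl p)) (ψ.restrictField K)) p 𝔭bar)
                          (∅ : Set (HeightOneSpectrum (𝓞 K)))),
                        Module.Finite (IwasawaAlgebra p) Dψ.X ∧ Module.IsTorsion (IwasawaAlgebra p) Dψ.X ∧
                          muInvariant p Dψ.X = 0 ∧ lambdaInvariant p Dψ.X = nφ))
    (han :
      (∀ (W : WeierstrassCurve ℚ) [W.IsElliptic] [W.IsGloballyMinimal] (p : ℕ) [Fact p.Prime],
        ∀ (N : ℕ) [NeZero N] (K : Type) [Field K] [NumberField K],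
          CellC W p → W.HasSplitMultiplicativeReductionAtPrime p → W.conductorNorm ℤ = N →
          IsImaginaryQuadratic K → NumberField.discr K < -4 → SatisfiesHeegnerHypothesis N K →
          Odd (NumberField.discr K) →
          ∀ (κ : ZpExtension K p), κ.IsAnticyclotomic →
            ∀ (γ : Field.absoluteGaloisGroup K) [Fact (κ.IsTopGenerator γ)]
              (𝔭 : HeightOneSpectrum (𝓞 K)), ((p : ℕ) : 𝓞 K) ∈ 𝔭.asIdeal →
              𝔭.asIdeal.ramificationIdx (𝓞 ℚ) = 1 → 𝔭.asIdeal.inertiaDeg (𝓞 ℚ) = 1 →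
              ∀ (𝔭bar : HeightOneSpectrum (𝓞 K)), ((p : ℕ) : 𝓞 K) ∈ 𝔭bar.asIdeal → 𝔭bar ≠ 𝔭 →
                ((Ideal.span {(p : ℤ)}).primesOver (𝓞 K)).ncard = 2 →
              ∀ (f : CuspForm (CongruenceSubgroup.Gamma0 N) 2), IsNewformOf W f →
                ∀ (ι' : PadicAlgCl p ≃+* ℂ),
                  (∀ (w : InfinitePlace K) (k : 𝓞 K),
                    k ∈ 𝔭.asIdeal ↔ ‖ι'.symm (w.embedding (k : K))‖ < 1) →
                  ∀ (ΩK : ℂ) (Ωp : ℂ_[p]) (Q : PowerSeries 𝓞_ℂ_[p]), ΩK ≠ 0 → ‖Ωp‖ = 1 →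
                    R1.IsBDPLFunctionInt p ι' 𝔭 κ γ f ΩK Ωp Q →
                      ∀ (Sf : Finset (HeightOneSpectrum (𝓞 K))),
                      (∀ w : HeightOneSpectrum (𝓞 K), w ∈ Sf ↔
                        (((W.conductorNorm ℤ : ℤ) : 𝓞 K) ∈ w.asIdeal ∧ ((p : ℕ) : 𝓞 K) ∉ w.asIdeal)) →
                      ∀ (Φ : AddSubgroup (geomTorsion W (p : ℤ))), IsRationalLine W p Φ →
                      ∀ (θsub θquot : FramedGaloisRep ℚ (padicCoeffIntegers (∅ : Set (PadicAlgCl p))) 1),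
                        IsTeichmullerLiftOn (∅ : Set (PadicAlgCl p)) (Φ.map (geomTorsion W (p : ℤ)).subtype) θsub →
                        IsTeichmullerLiftOnQuot (∅ : Set (PadicAlgCl p)) (Φ.map (geomTorsion W (p : ℤ)).subtype)
                          (geomTorsion W (p : ℤ)) θquot →
                      ∀ (φ ψ : FramedGaloisRep ℚ (padicCoeffIntegers (∅ : Set (PadicAlgCl p))) 1),
                        (φ = θsub ∧ ψ = θquot ∨ φ = θquot ∧ ψ = θsub) →
                        (∀ u : HeightOneSpectrum (𝓞 ℚ), ((p : ℕ) : 𝓞 ℚ) ∈ u.asIdeal → φ.IsUnramifiedAt u) →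
                      ∀ (θK : HeckeCharacter K), IsHeckeCharOf ι' (φ.restrictField K) θK →
                      ∀ (Cbar : Finset (HeightOneSpectrum (𝓞 K))), (∀ u ∈ Cbar, ¬ θK.IsUnramifiedAt u) →
                      ∀ (ΩK' : ℂ) (Ωp' : (unrIntegers p)ˣ) (Lφ : UnrSeries p), ΩK' ≠ 0 →
                        IsKatzLFunction ι' 𝔭 𝔭bar Cbar κ γ θK ΩK' ((Ωp' : unrIntegers p) : ℂ_[p]) Lφ →
                      ∀ nφ : ℕ, FirstUnitCoeffAt Lφ nφ →
                      ∀ m : ℕ, ‖((PowerSeries.coeff m Q : 𝓞_ℂ_[p]) : ℂ_[p])‖ = 1 →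
                        (∀ i < m, ‖((PowerSeries.coeff i Q : 𝓞_ℂ_[p]) : ℂ_[p])‖ < 1) →
                          m + ∑ w ∈ Sf, curveLocalLambda κ (W.baseChange K) w ≤
                            2 * nφ + ∑ w ∈ Sf, (charLocalLambda (∅ : Set (PadicAlgCl p)) κ (θsub.restrictField K) w +
                              charLocalLambda (∅ : Set (PadicAlgCl p)) κ (θquot.restrictField K) w))) :
    ∀ (W : WeierstrassCurve ℚ) [W.IsElliptic] [W.IsGloballyMinimal] (p : ℕ) [Fact p.Prime],
      ∀ (N : ℕ) [NeZero N] (K : Type) [Field K] [NumberField K],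
        CellC W p → W.HasSplitMultiplicativeReductionAtPrime p →
        (∀ Φ : AddSubgroup (geomTorsion W (p : ℤ)), IsRationalLine W p Φ → ¬ LineUnramifiedAt W p Φ) →
        W.conductorNorm ℤ = N → IsImaginaryQuadratic K → NumberField.discr K < -4 → SatisfiesHeegnerHypothesis N K →
        Odd (NumberField.discr K) →
        ∀ (κ : ZpExtension K p), κ.IsAnticyclotomic →
          ∀ (γ : Field.absoluteGaloisGroup K) [Fact (κ.IsTopGenerator γ)]
            (𝔭 : HeightOneSpectrum (𝓞 K)), ((p : ℕ) : 𝓞 K) ∈ 𝔭.asIdeal →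
            𝔭.asIdeal.ramificationIdx (𝓞 ℚ) = 1 → 𝔭.asIdeal.inertiaDeg (𝓞 ℚ) = 1 →
            ∀ (𝔭bar : HeightOneSpectrum (𝓞 K)), ((p : ℕ) : 𝓞 K) ∈ 𝔭bar.asIdeal → 𝔭bar ≠ 𝔭 →
              ((Ideal.span {(p : ℤ)}).primesOver (𝓞 K)).ncard = 2 →
            ∀ (f : CuspForm (CongruenceSubgroup.Gamma0 N) 2), IsNewformOf W f →
              ∀ (ι' : PadicAlgCl p ≃+* ℂ),
                (∀ (w : InfinitePlace K) (k : 𝓞 K),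
                  k ∈ 𝔭.asIdeal ↔ ‖ι'.symm (w.embedding (k : K))‖ < 1) →
                ∀ (ΩK : ℂ) (Ωp : ℂ_[p]) (Q : PowerSeries 𝓞_ℂ_[p]), ΩK ≠ 0 → ‖Ωp‖ = 1 →
                  R1.IsBDPLFunctionInt p ι' 𝔭 κ γ f ΩK Ωp Q →
                    ∀ (Sf : Finset (HeightOneSpectrum (𝓞 K))),
                    (∀ w : HeightOneSpectrum (𝓞 K), w ∈ Sf ↔
                      (((W.conductorNorm ℤ : ℤ) : 𝓞 K) ∈ w.asIdeal ∧ ((p : ℕ) : 𝓞 K) ∉ w.asIdeal)) →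
                    ∀ m : ℕ, ‖((PowerSeries.coeff m Q : 𝓞_ℂ_[p]) : ℂ_[p])‖ = 1 →
                      (∀ i < m, ‖((PowerSeries.coeff i Q : 𝓞_ℂ_[p]) : ℂ_[p])‖ < 1) →
                        m + ∑ w ∈ Sf, curveLocalLambda κ (W.baseChange K) w ≤
                          lambdaInvariant p (XAc (W.baseChange K) p κ 𝔭bar (↑Sf : Set (HeightOneSpectrum (𝓞 K))) γ) := by
  intro W _ _ p _ N _ K _ _ hc hsplitred hlat hN hK hd4 hHN hodd κ hκ γ _ 𝔭 h𝔭 he1 hf1 𝔭bar h𝔭bar hne hsplit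
    f hf ι' hι' ΩK Ωp Q hΩK hΩp hQ Sf hSf m hm hlt
  have hp2 : 2 < p := by
    have hp' := (Fact.out : p.Prime).two_le
    rcases hp'.lt_or_eq with h | h
    · exact h
    · exact absurd h.symm hc.2.1
  have hp2' : p ≠ 2 := by omega
  have hred : Red W p := hc.2.2.1
  have hmult : Mult W p := hc.2.2.2
  haveI : IsGalois ℚ K := isGalois_of_finrank_eq_two K hK.1
  have hHN' : SatisfiesHeegnerHypothesis (W.conductorNorm ℤ) K := hN ▸ hHN
  have hγ : κ.IsTopGenerator γ := Fact.out
  have hHp : SatisfiesHeegnerHypothesis p K := fun q hq hqp ↦ by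
    rw [(Nat.prime_dvd_prime_iff_eq hq (Fact.out : p.Prime)).mp hqp]; exact hsplit
  have hd3 : NumberField.discr K ≠ -3 := by omega
  set ι : K →+* ℚ_[p] := X11b.embAt K p 𝔭 h𝔭 he1 hf1 with hιdef
  have hvι : ∀ x : 𝓞 K, x ∈ 𝔭.asIdeal ↔ ‖ι (x : K)‖ < 1 := X11b.mem_asIdeal_iff_norm_embAt_lt_one 𝔭 h𝔭 he1 hf1
  -- (hlat) ⟹ a unique rational line (p679932 §2)
  have huniq : ∀ Φ Φ' : AddSubgroup (geomTorsion W (p : ℤ)), IsRationalLine W p Φ → IsRationalLine W p Φ' → Φ = Φ' :=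
    fun Φ Φ' hΦ hΦ' ↦ SplitMultWallHlat.eq_of_isRationalLine_of_forall_not_lineUnramifiedAt W hp2' hmult hlat hΦ hΦ'
  -- the Teichmüller pair over `ℚ` of a rational line and its restriction to `K`
  obtain ⟨Φ, hΦ, θs, θq, hs, hq⟩ := exists_teichmullerPair W p hred
  have hpair : IsResidualPairOver (W.baseChange K) p (θs.restrictField K) (θq.restrictField K) :=
    isResidualPairOver_restrictField W p K hΦ hs hq
  have hcardΦ : Nat.card (Φ.map (geomTorsion W (p : ℤ)).subtype) = p := by
    rw [Nat.card_congr (Φ.equivMapOfInjective (geomTorsion W (p : ℤ)).subtype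
      (geomTorsion W (p : ℤ)).subtype_injective).toEquiv.symm, hΦ.1]
  -- ORIENTATION: `θq` is the member unramified at `p` (the line is ramified: (hlat)), `θs|_K` ramified at `v̄`
  have hφp : ∀ u : HeightOneSpectrum (𝓞 ℚ), ((p : ℕ) : 𝓞 ℚ) ∈ u.asIdeal → θq.IsUnramifiedAt u := by
    rcases TeichmullerPairUnramifiedAtMult.teichmullerPair_isUnramifiedAt_or W p hp2' hmult hΦ hs hq with h | h
    · exact absurd (SplitMultWall.lineUnramifiedAt_of_isUnramifiedAt W hs h) (hlat Φ hΦ)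
    · exact h
  have hramI : ∃ τ ∈ inertia 𝔭bar, unitChar (θs.restrictField K) τ ≠ 1 :=
    SplitMultOrientation.exists_mem_inertia_unitChar_ne_one_of_split_of_isUnramifiedAt W K hp2' hsplitred hK hsplit h𝔭 h𝔭bar hne hpair
      (SplitMultWall.isUnramifiedAt_restrictField_of_forall θq hφp h𝔭bar)
  -- `E(K)[p] = 0` from the unique line moved by an inertia element at `v̄` (p678942)
  have htor : ∀ Q : (W.baseChange K).toAffine.Point, p • Q = 0 → Q = 0 := by
    obtain ⟨τ, -, hτ⟩ := hramI
    have hτ' : unitChar θs (absGaloisRestrict ℚ K τ) ≠ 1 := hτ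
    exact SplitMultLatticeBinders.torsion_eq_zero_of_unique_rationalLine W K (fun Ψ hΨ ↦ huniq Ψ Φ hΨ hΦ)
      ⟨τ, SplitMultLatticeBinders.exists_smul_ne_of_unitChar_ne_one W hΦ hs hτ'⟩
  -- `φ = θq` is Teichmüller and unramified off `N_E`
  have hTφ : ∀ σ : absoluteGaloisGroup ℚ, θq σ ^ (p - 1) = 1 := hq.1
  have hTφK : ∀ σ : absoluteGaloisGroup K, θq.restrictField K σ ^ (p - 1) = 1 := fun σ ↦ hTφ _
  have hunr : ∀ u : HeightOneSpectrum (𝓞 ℚ), ((W.conductorNorm ℤ : ℤ) : 𝓞 ℚ) ∉ u.asIdeal → θq.IsUnramifiedAt u := by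
    intro u hu
    by_cases hpu : ((p : ℕ) : 𝓞 ℚ) ∈ u.asIdeal
    · exact hφp u hpu
    · exact isUnramifiedAt_of_isTeichmullerLiftOnQuot W (∅ : Set (PadicAlgCl p)) hcardΦ hq
        (hasGoodReductionAt_of_conductorNorm_notMem W u hu) hpu
  -- the Hecke character `θ_K` of `φ|_{G_K}` and its Katz frame ([F1b])
  obtain ⟨θK, -, hθK'⟩ := exists_heckeCharacter_of_pow_eq_one (∅ : Set (PadicAlgCl p)) ι' (θq.restrictField K) hTφK
  have hθK : IsHeckeCharOf ι' (θq.restrictField K) θK := hθK'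
  obtain ⟨ΩK₁, Ωp₁, L₁, hΩK₁, hL₁⟩ :=
    hF1 p hp2 K hK hHp hodd hd3 ι 𝔭 𝔭bar hvι h𝔭bar hne κ hκ γ ι' hι' θq hTφ (W.conductorNorm ℤ) hHN' hunr hφp θK hθK
  have hCbar : ∀ u ∈ (∅ : Finset (HeightOneSpectrum (𝓞 K))), ¬ θK.IsUnramifiedAt u := by simp
  -- primitive unramified dual data of the two characters
  obtain ⟨D0sub⟩ := nonempty_unrDualData_char (∅ : Set (PadicAlgCl p)) (θs.restrictField K) κ 𝔭bar
    (∅ : Set (HeightOneSpectrum (𝓞 K))) hγ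
  obtain ⟨D0quot⟩ := nonempty_unrDualData_char (∅ : Set (PadicAlgCl p)) (θq.restrictField K) κ 𝔭bar
    (∅ : Set (HeightOneSpectrum (𝓞 K))) hγ
  -- [BR𝟙] at `φ = θq`: [RH] for every primitive datum, and `λ(D0quot) = nφ + [θq|_K = 𝟙]`
  obtain ⟨-, -, -, nφ, hnφ, hlamφ⟩ := hbr p hp2 K hK hHp hodd hd3 ι 𝔭 𝔭bar hvι h𝔭bar hne κ hκ γ ι' hι' θq hTφ (W.conductorNorm ℤ)
    hHN' hunr hφp θK hθK D0quot ∅ hCbar ΩK₁ Ωp₁ L₁ hΩK₁ hL₁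
  have hRHquot : ∀ D : DatumDualData κ γ (charModule (∅ : Set (PadicAlgCl p)) (θq.restrictField K))
      (Castella2018.AcSelmer.bdpData (charModule (∅ : Set (PadicAlgCl p)) (θq.restrictField K)) p 𝔭bar) (∅ : Set (HeightOneSpectrum (𝓞 K))),
      Module.Finite (IwasawaAlgebra p) D.X ∧ Module.IsTorsion (IwasawaAlgebra p) D.X ∧ muInvariant p D.X = 0 := fun D ↦ by
    obtain ⟨h1, h2, h3, -⟩ := hbr p hp2 K hK hHp hodd hd3 ι 𝔭 𝔭bar hvι h𝔭bar hne κ hκ γ ι' hι' θq hTφ (W.conductorNorm ℤ)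
      hHN' hunr hφp θK hθK D ∅ hCbar ΩK₁ Ωp₁ L₁ hΩK₁ hL₁
    exact ⟨h1, h2, h3⟩
  -- [BRω-split] at `ψ = θs`: [RH] for every primitive datum, and `λ(D0sub) = nφ`
  have hRHsub : ∀ D : DatumDualData κ γ (charModule (∅ : Set (PadicAlgCl p)) (θs.restrictField K))
      (Castella2018.AcSelmer.bdpData (charModule (∅ : Set (PadicAlgCl p)) (θs.restrictField K)) p 𝔭bar) (∅ : Set (HeightOneSpectrum (𝓞 K))),
      Module.Finite (IwasawaAlgebra p) D.X ∧ Module.IsTorsion (IwasawaAlgebra p) D.X ∧ muInvariant p D.X = 0 := fun D ↦ by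
    obtain ⟨h1, h2, h3, -⟩ := hω W p N K hc hsplitred hN hK hd4 hHN hodd κ hκ γ 𝔭 h𝔭 he1 hf1 𝔭bar h𝔭bar hne
      hsplit ι' hι' Φ hΦ θs θq hs hq θq θs (Or.inr ⟨rfl, rfl⟩) hφp θK hθK ∅ hCbar ΩK₁ Ωp₁ L₁ hΩK₁ hL₁ nφ hnφ D
    exact ⟨h1, h2, h3⟩
  obtain ⟨-, -, -, hlamψ⟩ := hω W p N K hc hsplitred hN hK hd4 hHN hodd κ hκ γ 𝔭 h𝔭 he1 hf1 𝔭bar h𝔭bar hne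
    hsplit ι' hι' Φ hΦ θs θq hs hq θq θs (Or.inr ⟨rfl, rfl⟩) hφp θK hθK ∅ hCbar ΩK₁ Ωp₁ L₁ hΩK₁ hL₁ nφ hnφ D0sub
  -- [AN-split]
  have h1 := han W p N K hc hsplitred hN hK hd4 hHN hodd κ hκ γ 𝔭 h𝔭 he1 hf1 𝔭bar h𝔭bar hne hsplit f hf ι' hι'
    ΩK Ωp Q hΩK hΩp hQ Sf hSf Φ hΦ θs θq hs hq θq θs (Or.inr ⟨rfl, rfl⟩) hφp θK hθK ∅ hCbar ΩK₁ Ωp₁ L₁ hΩK₁ hL₁ nφ hnφ m hm hlt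
  -- the E-side cotorsion WITHOUT Keller–Yin Lemma 5.1.1: [RH] at `Sf` for both characters (∅ → Sf), then the residual dévissage
  obtain ⟨DSsub⟩ := nonempty_unrDualData_char (∅ : Set (PadicAlgCl p)) (θs.restrictField K) κ 𝔭bar
    (↑Sf : Set (HeightOneSpectrum (𝓞 K))) hγ
  obtain ⟨DSquot⟩ := nonempty_unrDualData_char (∅ : Set (PadicAlgCl p)) (θq.restrictField K) κ 𝔭bar
    (↑Sf : Set (HeightOneSpectrum (𝓞 K))) hγ
  obtain ⟨hfgSs, htorSs, hμSs, -⟩ := SplitMultCharImprimitiveShift.imprimitive_clauses_of_split h263 h41 h42 h5A h32 W hp2 hsplitred hK hHN'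
    hvι h𝔭bar hne κ hκ γ hpair Sf hSf (θs.restrictField K) (Or.inl rfl) hRHsub D0sub DSsub
  obtain ⟨hfgSq, htorSq, hμSq, -⟩ := SplitMultCharImprimitiveShift.imprimitive_clauses_of_split h263 h41 h42 h5A h32 W hp2 hsplitred hK hHN'
    hvι h𝔭bar hne κ hκ γ hpair Sf hSf (θq.restrictField K) (Or.inr rfl) hRHquot D0quot DSquot
  have hTψK : ∀ σ : absoluteGaloisGroup K, θs.restrictField K σ ^ (p - 1) = 1 := fun σ ↦ hs.1 _
  obtain ⟨-, htorS, hμS⟩ := KellerYinLemma511OfCharRH.lemma511_conclusion_of_residualPair_of_dualData W hp2' hK h𝔭bar κ hκ γ Sf hSf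
    hTψK hTφK hpair DSsub DSquot ⟨hfgSs, htorSs, hμSs⟩ ⟨hfgSq, htorSq, hμSq⟩
  have hfgS : Module.IsTorsion (IwasawaAlgebra p) (Castella2018.AcSelmer.XAc (W.baseChange K) p κ 𝔭bar (↑Sf : Set (HeightOneSpectrum (𝓞 K))) γ) :=
    htorS
  haveI hfg : Module.Finite (IwasawaAlgebra p) (Castella2018.AcSelmer.XAc (W.baseChange K) p κ 𝔭bar (↑Sf : Set (HeightOneSpectrum (𝓞 K))) γ) :=
    Castella2018.AcSelmer.XAc.module_finite (W := W.baseChange K) (p := p) κ 𝔭bar (↑Sf : Set (HeightOneSpectrum (𝓞 K))) γ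
      (Finset.finite_toSet Sf)
  -- the algebraic side at the split datum (the x1 index road run at the split prime); `cd_p G_{K,S} ≤ 2` is the
  -- tree theorem at the totally complex `K` (THE ONE CHANGE w.r.t. p684434)
  have h2 := SplitMultAlgebraicSide.lambdaInvariant_primitive_add_sum_le_of_split h263 h41 h42 h5A h32 W hp2 hsplitred hK 
    (haveI := hK.2; groupCdLE_two_galoisGroupUnramifiedOutside_of_isTotallyComplex (K := K)) hHN' hsplit
    htor ι 𝔭 𝔭bar hvι h𝔭bar hne κ hκ γ (θs.restrictField K) (θq.restrictField K) hpair hramI Sf hSf D0sub D0quot hfg hfgS hμS hRHsub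
    hRHquot
  rw [hlamφ, hlamψ] at h2
  have e : lambdaInvariant p (Castella2018.AcSelmer.XAc (W.baseChange K) p κ 𝔭bar (↑Sf : Set (HeightOneSpectrum (𝓞 K))) γ) =
      lambdaInvariant p (XAc (W.baseChange K) p κ 𝔭bar (↑Sf : Set (HeightOneSpectrum (𝓞 K))) γ) := rfl
  rw [e] at h2
  omega

end Summit.BirchSwinnertonDyer.BirchSwinnertonDyer.Theorems.SplitMultWallHlatLight

end
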